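import Mathlib
import Summits.Ventures.FusionMHD.Models.RwmFRS1Kq07
import HarnessLib

/-!
# F3.r4 instance «RwmFRS1Kq07», companion mode `(3,1)`: Newcomb's `f`, `g`, the marginal equation in certificate form and
# the boundary form for the external `(3,1)` mode of MODEL M_RWM,K (`KinkEqQ07.hlK`, `q_a = 7/5`)

The `m = 3` companion of `RwmFRS1Kq07.lean` (model-6 g7; same MODEL M_RWM,K = row #95's exact force-balanced screw pinch
`KinkEqQ07.hlK` BY NAME — `Kq07.PK`, `Kq07.PK_Bθ`, `Kq07.deriv_p`, `Kq07.profile_regular` reused —, `R₀ = 5a`, `k = −1/5`,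
vacuum + thin resistive wall).  CLASS C = the external helical mode `(m, n) = (3, 1)`: `nq_a = 7/5 < 2 = m − 1`, `q = 3` at
`r² = 23/7` far in the vacuum, `F = (23 − 7r²)/(35(1+r²)) ≠ 0` in the plasma.  PURPOSE (honesty by kernel fact, as the `(4,1)`
companion of ★ #71): on the SAME exact equilibrium whose `(1,1)` internal kink is certified unstable (★ #95) and whose `(2,1)`
external mode is a resistive wall mode (#109-cand), the `(3,1)` external mode is on the no-wall STABLE side — `δW_∞ > 0`, no RWM
for any wall (`RwmFRS1Kq07M3Energy.lean`).  THIS FILE: closed forms of `F`, `F†`, `f`, `f′`, `g` for `(3, −1/5)` (pressure term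
included: `g = r·G₃(r²)/(1225(1+r²)³(r²+225)²)`, `G₃(s) = (23−7s)(1+s)G_{z,3}(s) − 400s(s+225)`,
`G_{z,3}(s) = (23−7s)(s+200)(s+225) − 50s(37+7s) ≥ 724616` on `[0,1]`), the integer ODE `Kq07M3.rwmEq3p`
(`P₂ = 25r²(23−7r²)²(1+r²)(r²+225)`, `P₁ = 25r(23−7r²)(15525 − 16177r² − 4829r⁴ − 7r⁶)`, `P₀ = −G₃(r²)`), the bridge to
lit-4's form, and the boundary form at `a = 1`: `F_a = 8/35`, `F†_a = −22/35`, `k₀²(a) = 226/25`,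
**`δŴ₃(L, Λ) = (32L − 88)/5537 + 64Λ/3675`**, `Λ_crit,3(L) = 3675(11 − 4L)/44296` [cite: Freidberg2014, §11.5.6 eq.
(11.148)–(11.149)].  Nothing about a device. [instance data]
-/

noncomputable section

open Set Polynomial Literature.MathematicalPhysics.MHD Literature.Computation.Certificates
  Literature.Computation.Certificates.LinearODE

namespace Summit.Ventures.FusionMHD.Models

namespace RwmFRS1

namespace Kq07M3

open Kq07

/-! ### Closed forms of `F`, `F†`, `f`, `g` for `(m, k) = (3, −1/5)` on MODEL M_RWM,K -/

/-- `F = kB_z + mB_θ/r = (23 − 7r²)/(35(1+r²))` for `m = 3` (`r ≠ 0`). [cite: Freidberg2014, §11.5.1 eq. (11.90)] -/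
theorem kDotB_eq {r : ℝ} (hr : r ≠ 0) : PK.kDotB 3 kk r = (23 - 7 * r ^ 2) / (35 * (1 + r ^ 2)) := by
  have h1 : (0 : ℝ) < 1 + r ^ 2 := by positivity
  rw [ScrewPinch.Profile.kDotB, PK_Bθ, PK_Bz, kk]
  field_simp
  ring

/-- `F† = −(37 + 7r²)/(35(1+r²))` for `m = 3` (`r ≠ 0`). [cite: Freidberg2014, §11.5.1 eq. (11.89)] -/
theorem kDotBDagger_eq {r : ℝ} (hr : r ≠ 0) : PK.kDotBDagger 3 kk r = -(37 + 7 * r ^ 2) / (35 * (1 + r ^ 2)) := by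
  have h1 : (0 : ℝ) < 1 + r ^ 2 := by positivity
  rw [ScrewPinch.Profile.kDotBDagger, PK_Bθ, PK_Bz, kk]
  field_simp
  ring

/-- Newcomb's `f = r³(23−7r²)²/(49(1+r²)²(r²+225))` for `m = 3` on MODEL M_RWM,K (`r ≠ 0`).
[cite: Freidberg2014, §11.5.1 eq. (11.90)] -/
theorem newcombF_eq {r : ℝ} (hr : r ≠ 0) :
    PK.newcombF 3 kk r = r ^ 3 * (23 - 7 * r ^ 2) ^ 2 / (49 * (1 + r ^ 2) ^ 2 * (r ^ 2 + 225)) := by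
  have h1 : (0 : ℝ) < 1 + r ^ 2 := by positivity
  have h2 : (0 : ℝ) < r ^ 2 + 225 := by positivity
  rw [ScrewPinch.Profile.newcombF, kDotB_eq hr, RwmFRS1.k0Sq_eq hr]
  field_simp
  ring

/-- `G_{z,3}(s) = (23−7s)(s+200)(s+225) − 50s(37+7s) = 1035000 − 307075s − 3302s² − 7s³`. [instance data] -/
def Gz (s : ℝ) : ℝ := 1035000 - 307075 * s - 3302 * s ^ 2 - 7 * s ^ 3

/-- `G_{z,3}(s) = (23−7s)(s+200)(s+225) − 50s(37+7s)`. [instance data] -/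
theorem Gz_eq (s : ℝ) : Kq07M3.Gz s = (23 - 7 * s) * (s + 200) * (s + 225) - 50 * s * (37 + 7 * s) := by
  unfold Kq07M3.Gz; ring

/-- `G_{z,3} ≥ 724616` on `[0, 1]`. [instance data] -/
theorem Gz_ge {s : ℝ} (h0 : 0 ≤ s) (h1 : s ≤ 1) : 724616 ≤ Kq07M3.Gz s := by
  unfold Kq07M3.Gz
  have h2 : s ^ 2 ≤ 1 := by nlinarith
  have h3 : s ^ 3 ≤ 1 := by nlinarith
  nlinarith

/-- `G₃(s) = (23−7s)(1+s)G_{z,3}(s) − 400s(s+225) = 23805000 + 9407275s − 12234546s² + 2096532s³ + 23002s⁴ + 49s⁵`.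
[instance data] -/
def Gpoly (s : ℝ) : ℝ := 23805000 + 9407275 * s - 12234546 * s ^ 2 + 2096532 * s ^ 3 + 23002 * s ^ 4 + 49 * s ^ 5

/-- `G₃ = (23−7s)(1+s)G_{z,3} − 400s(s+225)`. [instance data] -/
theorem Gpoly_eq (s : ℝ) : Kq07M3.Gpoly s = (23 - 7 * s) * (1 + s) * Kq07M3.Gz s - 400 * s * (s + 225) := by
  unfold Kq07M3.Gpoly Kq07M3.Gz; ring

/-- `G₃ > 0` on `[0, 1]` (`(23−7s)(1+s)G_{z,3} ≥ 16·724616 > 90400 ≥ 400s(s+225)`). [instance data] -/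
theorem Gpoly_pos {s : ℝ} (h0 : 0 ≤ s) (h1 : s ≤ 1) : 0 < Kq07M3.Gpoly s := by
  rw [Gpoly_eq]
  have hG := Gz_ge h0 h1
  have h16 : 16 ≤ (23 - 7 * s) * (1 + s) := by nlinarith
  have hprod : 16 * 724616 ≤ (23 - 7 * s) * (1 + s) * Kq07M3.Gz s := by
    have := mul_le_mul h16 hG (by norm_num) (by nlinarith)
    linarith
  nlinarith

/-- Newcomb's `g` (11.90) for `m = 3` WITH the force-balance pressure: `g = r·G₃(r²)/(1225(1+r²)³(r²+225)²)` (`r ≠ 0`).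
[cite: Freidberg2014, §11.5.1 eq. (11.90)] -/
theorem newcombG_eq {r : ℝ} (hr : r ≠ 0) :
    PK.newcombG 3 kk r = r * Kq07M3.Gpoly (r ^ 2) / (1225 * (1 + r ^ 2) ^ 3 * (r ^ 2 + 225) ^ 2) := by
  have h1 : (0 : ℝ) < 1 + r ^ 2 := by positivity
  have h2 : (0 : ℝ) < r ^ 2 + 225 := by positivity
  rw [ScrewPinch.Profile.newcombG, deriv_p, kDotB_eq hr, kDotBDagger_eq hr, RwmFRS1.k0Sq_eq hr, Kq07M3.Gpoly, kk, PK_μ₀]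
  field_simp
  ring

/-- `F ≠ 0` on `0 < r`, `r² < 23/7` (mode `(3,1)`: `q = 3` far in the vacuum). [instance data] -/
theorem kDotB_ne_zero {r : ℝ} (hr : 0 < r) (h : r ^ 2 < 23 / 7) : PK.kDotB 3 kk r ≠ 0 := by
  rw [kDotB_eq hr.ne']
  have h1 : (0 : ℝ) < 1 + r ^ 2 := by positivity
  exact div_ne_zero (by nlinarith) (by positivity)

/-- `f > 0` on `0 < r`, `r² < 23/7`, `m = 3`. [instance data] -/
theorem newcombF_pos {r : ℝ} (hr : 0 < r) (h : r ^ 2 < 23 / 7) : 0 < PK.newcombF 3 kk r := by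
  rw [newcombF_eq hr.ne']
  have h3 : (0 : ℝ) < (23 - 7 * r ^ 2) ^ 2 := by nlinarith
  positivity

/-- `g > 0` on the plasma `0 < r ≤ 1`, `m = 3`. [instance data] -/
theorem newcombG_pos {r : ℝ} (hr : 0 < r) (h : r ≤ 1) : 0 < PK.newcombG 3 kk r := by
  rw [newcombG_eq hr.ne']
  have hr2 : r ^ 2 ≤ 1 := by nlinarith
  have hG := Gpoly_pos (sq_nonneg r) hr2
  positivity

/-! ### The marginal equation in certificate form and the bridge -/

/-- The `(3,1)` marginal equation of MODEL M_RWM,K cleared of denominators: `P₂ = 25r²(23−7r²)²(1+r²)(r²+225)`,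
`P₁ = 25r(23−7r²)(15525 − 16177r² − 4829r⁴ − 7r⁶)`, `P₀ = −G₃(r²)`. [instance data] -/
def rwmEq3p : Equation :=
  ⟨[0, 0, 2975625, 0, 1177600, 0, -1530450, 0, 268800, 0, 1225], [0, 8926875, 0, -12018650, 0, 54300, 0, 841050, 0, 1225],
    [-23805000, 0, -9407275, 0, 12234546, 0, -2096532, 0, -23002, 0, -49]⟩

/-- `P₂(r) = 25r²(23−7r²)²(1+r²)(r²+225)`. [instance data] -/
theorem eval_P2 (r : ℝ) :
    (toPolyR Kq07M3.rwmEq3p.P2).eval r = 25 * r ^ 2 * (23 - 7 * r ^ 2) ^ 2 * (1 + r ^ 2) * (r ^ 2 + 225) := by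
  simp [Kq07M3.rwmEq3p, toPolyR, Finset.sum_range_succ]
  ring

/-- `P₁(r) = 25r(23−7r²)(15525 − 16177r² − 4829r⁴ − 7r⁶)`. [instance data] -/
theorem eval_P1 (r : ℝ) :
    (toPolyR Kq07M3.rwmEq3p.P1).eval r =
      25 * r * (23 - 7 * r ^ 2) * (15525 - 16177 * r ^ 2 - 4829 * r ^ 4 - 7 * r ^ 6) := by
  simp [Kq07M3.rwmEq3p, toPolyR, Finset.sum_range_succ]
  ring

/-- `P₀(r) = −G₃(r²)`. [instance data] -/
theorem eval_P0 (r : ℝ) : (toPolyR Kq07M3.rwmEq3p.P0).eval r = -Kq07M3.Gpoly (r ^ 2) := by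
  rw [Kq07M3.Gpoly]
  simp [Kq07M3.rwmEq3p, toPolyR, Finset.sum_range_succ]
  ring

/-- `P₂ ≠ 0` on `0 < r`, `r² < 23/7`. [instance data] -/
theorem eval_P2_ne_zero {r : ℝ} (hr : 0 < r) (h : r ^ 2 < 23 / 7) : (toPolyR Kq07M3.rwmEq3p.P2).eval r ≠ 0 := by
  rw [eval_P2]
  have h8 : (0 : ℝ) < (23 - 7 * r ^ 2) ^ 2 := by nlinarith
  positivity

/-- `𝔭 = −P₁/P₂`. [instance data] -/
theorem pH_eq {r : ℝ} (hr : 0 < r) (h : r ^ 2 < 23 / 7) :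
    Kq07M3.rwmEq3p.pH r = -(15525 - 16177 * r ^ 2 - 4829 * r ^ 4 - 7 * r ^ 6) /
      (r * (23 - 7 * r ^ 2) * (1 + r ^ 2) * (r ^ 2 + 225)) := by
  have h8 : (23 - 7 * r ^ 2 : ℝ) ≠ 0 := by nlinarith
  have h1 : (0 : ℝ) < 1 + r ^ 2 := by positivity
  have h2 : (0 : ℝ) < r ^ 2 + 225 := by positivity
  have hr0 := hr.ne'
  rw [Equation.pH, eval_P1, eval_P2]
  field_simp

/-- `𝔮 = −P₀/P₂`. [instance data] -/
theorem qH_eq (r : ℝ) :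
    Kq07M3.rwmEq3p.qH r = Kq07M3.Gpoly (r ^ 2) / (25 * r ^ 2 * (23 - 7 * r ^ 2) ^ 2 * (1 + r ^ 2) * (r ^ 2 + 225)) := by
  rw [Equation.qH, eval_P0, eval_P2]
  ring

/-- `f′ = r²(23−7r²)(15525 − 16177r² − 4829r⁴ − 7r⁶)/(49(1+r²)³(r²+225)²)` on `0 < r`, `m = 3`. [instance data] -/
theorem hasDerivAt_newcombF {r : ℝ} (hr : 0 < r) :
    HasDerivAt (PK.newcombF 3 kk)
      (r ^ 2 * (23 - 7 * r ^ 2) * (15525 - 16177 * r ^ 2 - 4829 * r ^ 4 - 7 * r ^ 6) /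
        (49 * (1 + r ^ 2) ^ 3 * (r ^ 2 + 225) ^ 2)) r := by
  have h1 : (0 : ℝ) < 1 + r ^ 2 := by positivity
  have h2 : (0 : ℝ) < r ^ 2 + 225 := by positivity
  have hev : (fun s => s ^ 3 * (23 - 7 * s ^ 2) ^ 2 / (49 * (1 + s ^ 2) ^ 2 * (s ^ 2 + 225))) =ᶠ[nhds r]
      PK.newcombF 3 kk := by
    filter_upwards [isOpen_Ioi.mem_nhds hr] with s hs
    rw [newcombF_eq (ne_of_gt hs)]
  have hd : HasDerivAt (fun s : ℝ => s ^ 3 * (23 - 7 * s ^ 2) ^ 2 / (49 * (1 + s ^ 2) ^ 2 * (s ^ 2 + 225)))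
      (((3 * r ^ 2 * (23 - 7 * r ^ 2) ^ 2 + r ^ 3 * (2 * (23 - 7 * r ^ 2) * (-(7 * (2 * r))))) *
          (49 * (1 + r ^ 2) ^ 2 * (r ^ 2 + 225)) -
        r ^ 3 * (23 - 7 * r ^ 2) ^ 2 * (49 * (2 * (1 + r ^ 2) * (2 * r)) * (r ^ 2 + 225) + 49 * (1 + r ^ 2) ^ 2 * (2 * r))) /
        (49 * (1 + r ^ 2) ^ 2 * (r ^ 2 + 225)) ^ 2) r := by
    have hnum : HasDerivAt (fun s : ℝ => s ^ 3 * (23 - 7 * s ^ 2) ^ 2)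
        (3 * r ^ 2 * (23 - 7 * r ^ 2) ^ 2 + r ^ 3 * (2 * (23 - 7 * r ^ 2) * (-(7 * (2 * r))))) r := by
      have ha := hasDerivAt_pow 3 r
      have hb : HasDerivAt (fun s : ℝ => 23 - 7 * s ^ 2) (-(7 * (2 * r))) r := by
        simpa using ((hasDerivAt_pow 2 r).const_mul 7).const_sub 23
      have hb2 := hb.pow 2
      exact (ha.mul hb2).congr_deriv (by simp only [Pi.pow_apply]; push_cast; ring)
    have hden : HasDerivAt (fun s : ℝ => 49 * (1 + s ^ 2) ^ 2 * (s ^ 2 + 225))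
        (49 * (2 * (1 + r ^ 2) * (2 * r)) * (r ^ 2 + 225) + 49 * (1 + r ^ 2) ^ 2 * (2 * r)) r := by
      have hc : HasDerivAt (fun s : ℝ => 1 + s ^ 2) (2 * r) r := by
        simpa using (hasDerivAt_pow 2 r).const_add 1
      have hc2 := (hc.pow 2).const_mul 49
      have he : HasDerivAt (fun s : ℝ => s ^ 2 + 225) (2 * r) r := by
        simpa using (hasDerivAt_pow 2 r).add_const 225
      exact (hc2.mul he).congr_deriv (by simp only [Pi.pow_apply]; push_cast; ring)
    exact hnum.div hden (by positivity)
  refine (hd.congr_of_eventuallyEq hev.symm).congr_deriv ?_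
  field_simp
  ring

/-- **BRIDGE** (`m = 3`): a certificate solution of `Kq07M3.rwmEq3p` on an open `s ⊆ {0 < r, r² < 23/7}` satisfies
`d/dr (f · deriv ξ) = g ξ`. [cite: Freidberg2014, §11.5.3 eq. (11.110)] -/
theorem newcomb_of_isSolOn {ξ ξ' : ℝ → ℝ} {s : Set ℝ} (hs : IsOpen s) (hsub : ∀ r ∈ s, 0 < r ∧ r ^ 2 < 23 / 7)
    (hsol : Kq07M3.rwmEq3p.IsSolOn ξ ξ' s) {r : ℝ} (hr : r ∈ s) :
    HasDerivAt (fun x => PK.newcombF 3 kk x * deriv ξ x) (PK.newcombG 3 kk r * ξ r) r := by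
  obtain ⟨hr0, hr8⟩ := hsub r hr
  obtain ⟨h1, h2⟩ := hsol r hr
  have hev : ξ' =ᶠ[nhds r] deriv ξ := by
    filter_upwards [hs.mem_nhds hr] with x hx
    exact ((hsol x hx).1.deriv).symm
  have h2' : HasDerivAt (deriv ξ) (Kq07M3.rwmEq3p.pH r * ξ' r + Kq07M3.rwmEq3p.qH r * ξ r) r :=
    h2.congr_of_eventuallyEq hev.symm
  have hf := hasDerivAt_newcombF hr0
  have hprod := hf.mul h2'
  refine hprod.congr_deriv ?_
  rw [h1.deriv, newcombF_eq hr0.ne', newcombG_eq hr0.ne', pH_eq hr0 hr8, qH_eq]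
  have h8 : (23 - 7 * r ^ 2 : ℝ) ≠ 0 := by nlinarith
  have h8b : (23 : ℝ) - r ^ 2 * 7 ≠ 0 := by nlinarith
  have h8sq : ((23 : ℝ) - 7 * r ^ 2) ^ 2 ≠ 0 := pow_ne_zero 2 h8
  have h1' : (0 : ℝ) < 1 + r ^ 2 := by positivity
  have h2'' : (0 : ℝ) < r ^ 2 + 225 := by positivity
  have hr0' := hr0.ne'
  field_simp
  ring

/-! ### The boundary form at `a = 1`, `m = 3` -/

/-- Edge values (`m = 3`): `F_a = 8/35`, `F†_a = −22/35`, `k₀²(a) = 226/25`, `f(a) = 32/5537`. [instance data] -/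
theorem edge_values : PK.kDotB 3 kk 1 = 8 / 35 ∧ PK.kDotBDagger 3 kk 1 = -22 / 35 ∧
    ScrewPinch.Profile.k0Sq 3 kk 1 = 226 / 25 ∧ PK.newcombF 3 kk 1 = 32 / 5537 := by
  refine ⟨?_, ?_, ?_, ?_⟩
  · rw [kDotB_eq one_ne_zero]; norm_num
  · rw [kDotBDagger_eq one_ne_zero]; norm_num
  · rw [RwmFRS1.k0Sq_eq one_ne_zero]; norm_num
  · rw [newcombF_eq one_ne_zero]; norm_num

/-- THE BOUNDARY FORM per `ξ(a)²` for `m = 3` on MODEL M_RWM,K: `δŴ₃(L, Λ) := (F²/k₀²) L + FF†/k₀² + a²F²Λ/3` at `a = 1`.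
[cite: Freidberg2014, §11.5.6 eq. (11.148)–(11.149)] -/
def boundaryForm (L Λ : ℝ) : ℝ :=
  PK.kDotB 3 kk 1 ^ 2 / ScrewPinch.Profile.k0Sq 3 kk 1 * L +
    PK.kDotB 3 kk 1 * PK.kDotBDagger 3 kk 1 / ScrewPinch.Profile.k0Sq 3 kk 1 +
    1 ^ 2 * PK.kDotB 3 kk 1 ^ 2 * Λ / 3

/-- **`δŴ₃(L, Λ) = (32L − 88)/5537 + 64Λ/3675`** (exact). [instance data] -/
theorem boundaryForm_eq (L Λ : ℝ) : Kq07M3.boundaryForm L Λ = (32 * L - 88) / 5537 + 64 * Λ / 3675 := by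
  obtain ⟨e1, e2, e3, -⟩ := edge_values
  rw [Kq07M3.boundaryForm, e1, e2, e3]
  ring

/-- lit-4's right-hand side at `a = 1`, `m = 3` for MODEL M_RWM,K is `δŴ₃`. [cite: Freidberg2014, §11.5.3 eq. (11.118)] -/
theorem boundaryForm_mul (ξ₁ : ℝ → ℝ) (Λ : ℝ) :
    (PK.kDotB 3 kk 1 ^ 2 / ScrewPinch.Profile.k0Sq 3 kk 1 * (1 * deriv ξ₁ 1 / ξ₁ 1) +
        PK.kDotB 3 kk 1 * PK.kDotBDagger 3 kk 1 / ScrewPinch.Profile.k0Sq 3 kk 1 +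
        1 ^ 2 * PK.kDotB 3 kk 1 ^ 2 * Λ / 3) * ξ₁ 1 ^ 2 =
      Kq07M3.boundaryForm (1 * deriv ξ₁ 1 / ξ₁ 1) Λ * ξ₁ 1 ^ 2 := by
  rw [Kq07M3.boundaryForm]

/-- `δŴ₃` is strictly increasing in `Λ`. [cite: Freidberg2014, §11.5.6 eq. (11.150)] -/
theorem boundaryForm_strictMono (L : ℝ) : StrictMono (Kq07M3.boundaryForm L) := by
  intro x y hxy
  rw [boundaryForm_eq, boundaryForm_eq]
  linarith

/-- `Λ_crit,3(L) = 3675(11 − 4L)/44296`. [instance data] -/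
def lambdaCrit (L : ℝ) : ℝ := 3675 * (11 - 4 * L) / 44296

/-- `δŴ₃(L, Λ) = 64(Λ − Λ_crit,3)/3675`. [instance data] -/
theorem boundaryForm_eq_sub (L Λ : ℝ) : Kq07M3.boundaryForm L Λ = 64 * (Λ - Kq07M3.lambdaCrit L) / 3675 := by
  rw [boundaryForm_eq, Kq07M3.lambdaCrit]
  ring

/-- `δŴ₃ > 0 ⟺ Λ > Λ_crit,3`. [instance data] -/
theorem boundaryForm_pos_iff (L Λ : ℝ) : 0 < Kq07M3.boundaryForm L Λ ↔ Kq07M3.lambdaCrit L < Λ := by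
  rw [boundaryForm_eq_sub]
  constructor
  · intro h; by_contra hle; rw [not_lt] at hle
    have : 64 * (Λ - Kq07M3.lambdaCrit L) / 3675 ≤ 0 := div_nonpos_of_nonpos_of_nonneg (by linarith) (by norm_num)
    linarith
  · intro h; exact div_pos (by linarith) (by norm_num)

end Kq07M3

end RwmFRS1

end Summit.Ventures.FusionMHD.Models

end
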